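import Summits.BirchSwinnertonDyer.BirchSwinnertonDyer.Theses.ResidualThetaTransportAtTwo
import Summits.BirchSwinnertonDyer.BirchSwinnertonDyer.Theorems.ResidualThetaTransportAtTwoSignedMuVanishingAtTwoPlusAnalyticAtW
import Summits.BirchSwinnertonDyer.BirchSwinnertonDyer.Theorems.ThetaPartnerAtTwoSignedTransportAtTwoResidualFiniteness
import HarnessLib

/-!
# Route `ResidualThetaTransportAtTwo`, crux Kμ⁺ `SignedMuVanishingAtTwoPlus` (stmt-BirchSwinnertonDyer-20689):
# the line `birth` v3 END TO END — the crux BY NAME from its three registered stub statements, sorry-free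

Lead line `birth`, seat bsd-wall-rtt-p4 (helper; THEOREMS ONLY; the three stub statements are explicit inline
hypotheses, nothing about any curve is asserted; BSD is not proved by this). This is the kernel certificate that
the registered skeleton `Cruxes/SignedMuVanishingAtTwoPlus/Lines/birth.lean` (v3) composes: with
* (RESID) residual finiteness — every finitely generated `+` signed Selmer dual `X⁺` of a habitat⁺ curve over the
  cyclotomic `ℤ₂`-extension has finite `X⁺/2X⁺` (stub `stub_signedResidualFiniteAtTwo`; research, = children
  21438/21439 at the residual level, file `…Residual`);
* (PER) the period unit at `2` — `Ω_W = u·Ω⁺_f`, `|u|₂ = 1` (stub `stub_periodUnitAtTwo`; PRINT, Abbes–Ullmo Thm A,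
  discharged modulo the tree fact `abbesUllmo_not_dvd_maninConstant_of_not_dvd_level`);
* (FLAT) `2 ∤ L♭` for every Pollack pair at `2` of every habitat⁺ newform (stub `stub_flatMuZeroAtTwo`; research
  residue, per-class certifiable, file `…AnalyticAtW`),
`signedMuVanishingAtTwoPlus_of_residualFinite_of_periodUnit_of_flatMuZero` proves the crux decl, and
`signedMuVanishingAtTwoPlus_of_residualFinite_of_abbesUllmo_of_flatMuZero` the same GRANTED Abbes–Ullmo in place
of (PER). (Converses — given (PER) the crux implies (RESID) ∧ (FLAT), so the reshaped stubs lose nothing — are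
landed in `…AnalyticChild` (`flatMuZero_of_signedMuAnalyticAtTwoPlus_of_periodUnit`) and `…Residual`
(`residualFinite_of_signedMuVanishingAtTwoPlus`).) Imports only route-independent helper modules besides the
route file (the `Λ`-algebra `X/pX finite ⇒ torsion ∧ μ = 0` is the sibling lead's
`SignedTransportAtTwo.isTorsion_and_muInvariant_eq_zero_of_finite_quotient`).
[cite: GreenbergVatsal2000, p. 3 and Prop. (2.8)] [cite: Pollack2003, Prop. 6.18] [cite: AbbesUllmo1996, Thm. A]
-/

set_option autoImplicit false
set_option linter.dupNamespace false

noncomputable section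

open scoped Classical MatrixGroups ModularForm

open CongruenceSubgroup WeierstrassCurve Literature.NumberTheory.EllipticCurves
  Literature.NumberTheory.EllipticCurves.IwasawaAlgebra Literature.NumberTheory.EllipticCurves.ModularForms
  Literature.NumberTheory.EllipticCurves.Rank1Residual Literature.NumberTheory.EllipticCurves.Kobayashi2003
  Summit.BirchSwinnertonDyer.Rank1Residual.Supersingular
  Summit.BirchSwinnertonDyer.BirchSwinnertonDyer.Theses.ResidualThetaTransportAtTwo

namespace Summit.BirchSwinnertonDyer.BirchSwinnertonDyer.Theorems

/-- **Line `birth` v3, end to end: (RESID) ∧ (PER) ∧ (FLAT) ⇒ `SignedMuVanishingAtTwoPlus`.** The algebraic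
conjunct is residual finiteness read back through `X/2X finite ⇒ X torsion ∧ μ = 0`
(`SignedTransportAtTwo.isTorsion_and_muInvariant_eq_zero_of_finite_quotient`; `D.mu = muInvariant 2 D.X`); the
analytic conjunct is (PER) ∧ (FLAT) through the `Λ`-algebra of the `μ(G) = m` bookkeeping
(`SignedMuAtTwo.mu_eq_of_isPollackPair_two_of_periodUnit_of_not_two_dvd`).
[cite: GreenbergVatsal2000, p. 3 (proof of Thm. (1.4))] [cite: Pollack2003, Prop. 6.18] -/
theorem signedMuVanishingAtTwoPlus_of_residualFinite_of_periodUnit_of_flatMuZero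
    (hres : ∀ (W : WeierstrassCurve ℚ) [W.IsElliptic] [W.IsGloballyMinimal], ¬ W.HasCM → W.analyticRank = 0 →
      GoodSS W 2 → W.frobeniusTrace 2 = 0 → W.Δ < 0 →
      ∀ (κ : ZpExtension ℚ 2) (γ : Field.absoluteGaloisGroup ℚ), κ.IsCyclotomic → κ.IsTopGenerator γ →
      ∀ (D : SignedSelmerDualData W κ γ 1) [Module.Finite (IwasawaAlgebra 2) D.X],
        Finite (D.X ⧸ (augIdealP 2 • ⊤ : Submodule (IwasawaAlgebra 2) D.X)))
    (hper : ∀ (W : WeierstrassCurve ℚ) [W.IsElliptic] [W.IsGloballyMinimal], GoodSS W 2 →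
      ∀ [NeZero (W.conductorNorm ℤ)] (f : CuspForm (Gamma0 (W.conductorNorm ℤ)) 2), IsNewformOf W f →
      ∃ u : ℚ, ‖(u : ℚ_[2])‖ = 1 ∧ W.realPeriodRat = u * plusPeriod f)
    (hflat : ∀ (W : WeierstrassCurve ℚ) [W.IsElliptic] [W.IsGloballyMinimal], ¬ W.HasCM →
      W.analyticRank = 0 → GoodSS W 2 → W.frobeniusTrace 2 = 0 → W.Δ < 0 →
      ∀ [NeZero (W.conductorNorm ℤ)] (f : CuspForm (Gamma0 (W.conductorNorm ℤ)) 2), IsNewformOf W f →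
      ∀ (Lplus Lminus : IwasawaAlgebra 2), IsPollackPair f 2 Lplus Lminus →
      ¬ PowerSeries.C (2 : ℤ_[2]) ∣ Lminus) :
    SignedMuVanishingAtTwoPlus := by
  intro W _ _ hCM hr hss ha hΔ
  refine ⟨fun κ γ hκ hγ D _ ↦ ?_, fun γ _ _ f hf ϖ hϖ Lplus Lminus hP G m hG ↦ ?_⟩
  · exact SignedTransportAtTwo.isTorsion_and_muInvariant_eq_zero_of_finite_quotient
      (hres W hCM hr hss ha hΔ κ γ hκ hγ D)
  · exact SignedMuAtTwo.mu_eq_of_isPollackPair_two_of_periodUnit_of_not_two_dvd hϖ (hper W hss f hf)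
      (hflat W hCM hr hss ha hΔ f hf Lplus Lminus hP) G m hG

/-- **GRANTED Abbes–Ullmo: (RESID) ∧ (FLAT) ⇒ `SignedMuVanishingAtTwoPlus`** — the crux modulo its two research
residues and one print fact. [cite: AbbesUllmo1996, Thm. A] [cite: GreenbergVatsal2000, p. 3] [cite: Pollack2003, Prop. 6.18] -/
theorem signedMuVanishingAtTwoPlus_of_residualFinite_of_abbesUllmo_of_flatMuZero
    (hres : ∀ (W : WeierstrassCurve ℚ) [W.IsElliptic] [W.IsGloballyMinimal], ¬ W.HasCM → W.analyticRank = 0 →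
      GoodSS W 2 → W.frobeniusTrace 2 = 0 → W.Δ < 0 →
      ∀ (κ : ZpExtension ℚ 2) (γ : Field.absoluteGaloisGroup ℚ), κ.IsCyclotomic → κ.IsTopGenerator γ →
      ∀ (D : SignedSelmerDualData W κ γ 1) [Module.Finite (IwasawaAlgebra 2) D.X],
        Finite (D.X ⧸ (augIdealP 2 • ⊤ : Submodule (IwasawaAlgebra 2) D.X)))
    (hAU : abbesUllmo_not_dvd_maninConstant_of_not_dvd_level)
    (hflat : ∀ (W : WeierstrassCurve ℚ) [W.IsElliptic] [W.IsGloballyMinimal], ¬ W.HasCM →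
      W.analyticRank = 0 → GoodSS W 2 → W.frobeniusTrace 2 = 0 → W.Δ < 0 →
      ∀ [NeZero (W.conductorNorm ℤ)] (f : CuspForm (Gamma0 (W.conductorNorm ℤ)) 2), IsNewformOf W f →
      ∀ (Lplus Lminus : IwasawaAlgebra 2), IsPollackPair f 2 Lplus Lminus →
      ¬ PowerSeries.C (2 : ℤ_[2]) ∣ Lminus) :
    SignedMuVanishingAtTwoPlus :=
  signedMuVanishingAtTwoPlus_of_residualFinite_of_periodUnit_of_flatMuZero hres
    (fun _ _ _ hss _ _ hf ↦ SignedMuAtTwo.exists_periodUnit_two_of_abbesUllmo hAU hss hf) hflat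

end Summit.BirchSwinnertonDyer.BirchSwinnertonDyer.Theorems

end
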